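import Summits.HodgeConjecture.CorCM.MumfordTateRankRibetTypeOnePairsRigidDistinctFields
import Literature.AlgebraicGeometry.Motives.HodgeLieRigidityTraceCriterion
import Literature.AlgebraicGeometry.Motives.HodgeLieRigidDuplicateSummand
import HarnessLib

/-!
# Two abelian varieties with imaginary-quadratic `End⁰`, unbalanced multiplicities and NON-ISOMORPHIC fields: `H¹(A₁ × A₂)` is `Θ`-rigid
# (the centre of `Lie Hg` lies on `ℚE₁ ⊕ ℚE₂`, and `x₁ tr(E₁Θ) + x₂ tr(E₂Θ) = 2i(x₁k₁√d₁ + x₂k₂√d₂) ≠ 0` since `√(d₁/d₂) ∉ ℚ` — the trace criterion)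

COR-CM (cell `pub-hodgecm2`, seat `b27` gen 54, count-neutral Mumford–Tate-rank ladder; theorems only, no definition, no named fact; UNCONDITIONAL —
nothing here uses or asserts HC_CM).  Generalises `CorCM/MumfordTateRankRibetTypeOnePairsRigidDistinctFields` (Ribet types, multiplicity one)
to ARBITRARY unbalanced signatures, by gen 54ʼs exact criterion (`Motives/HodgeLieRigidityTraceCriterion.rigid_of_forall_center_trace_theta`):
for `A_i` (`i = 1, 2`) with `dim_ℚ End⁰A_i = 2`, `φ_i ∘ φ_i = −d_i`, `n_{i√d_i} ≠ n_{−i√d_i}`, and no ring homomorphism `End⁰A₂ → End⁰A₁`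
(`d₁ ≠ s²d₂`), every `ψ`-skew central Hodge endomorphism of `H¹(A₁ × A₂)` is `x₁E₁ + x₂E₂`, `E_i = ι_iφ_i^*π_i` (`quadraticEnd_skewCentre_data`
blockwise), and `tr((x₁E₁ + x₂E₂)_ℂ Θ) = x₁·2i√d₁k₁ + x₂·2i√d₂k₂` (`k_i = n₊ − n₋ ≠ 0`) vanishes only for `x₁ = x₂ = 0`.
* **`hodgeLie_rigid_prod_quadraticEnd_of_isEmpty_ringHom`** — `H¹(A₁ × A₂)` is `Θ`-rigid; **`mtRank_hodge_one_le_of_isIsogenous_quadraticEnd_pair_prod`**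
  — `t(X) ≥ t(A₁ × A₂)` for `X ∼ (A₁ × A₂) × Y`.

## References
* [MoonenZarhin1999LowDim] B. Moonen, Yu. G. Zarhin, *Hodge classes on abelian varieties of low dimension*, Math. Ann. 315 (1999), §2 (2.3), §3 (3.1), (3.8)
  [corpus: paper:arxiv-math_9901113 pp. 5–7]. [cite: MoonenZarhin1999LowDim, §3 (3.1)]
* [Gordon1997] B. B. Gordon, *A survey of the Hodge conjecture for abelian varieties*, 1.13.2. [cite: Gordon1997, 1.13.2]
* [Deligne1982HodgeCycles] P. Deligne, LNM 900 (1982), I §3 Prop. 3.6. [cite: Deligne1982HodgeCycles, I §3 Prop. 3.6]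
-/

noncomputable section

open scoped TensorProduct
open CategoryTheory CategoryTheory.Limits Module NumberField

namespace Summit.HodgeConjecture.CorCM

open Literature.AlgebraicGeometry.Motives
open Literature.AlgebraicGeometry.Motives.AbelianVariety
open Literature.AlgebraicGeometry.Motives.HodgeStructure
open Literature.AlgebraicGeometry.HodgeTheory
open Literature.AlgebraicGeometry.ComplexMultiplication

variable [HodgeTensorFacts.{0, 0}] {X : AbelianVariety ℂ} {n : ℕ}

omit [HodgeTensorFacts.{0, 0}] in
/-- Rational independence of `√d₁`, `√d₂` when `d₁ ≠ s²d₂`: `x₁·2i√d₁·m₁ + x₂·2i√d₂·m₂ = 0` with `m₁, m₂ ≠ 0` forces `x₁ = x₂ = 0`.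
[cite: MoonenZarhin1999LowDim, §3 (3.1)] -/
private theorem eq_zero_and_eq_zero_of_sqrt_combination {d₁ d₂ : ℕ} (hd₂ : 0 < d₂) (hfree : ∀ s : ℚ, (d₁ : ℚ) ≠ s ^ 2 * d₂)
    {x₁ x₂ : ℚ} {m₁ m₂ : ℂ} {k₁ k₂ : ℤ} (hm₁ : m₁ = k₁) (hm₂ : m₂ = k₂) (hk₁ : k₁ ≠ 0) (hk₂ : k₂ ≠ 0)
    (h : (x₁ : ℂ) * (2 * (Complex.I * (Real.sqrt d₁ : ℂ)) * m₁) + (x₂ : ℂ) * (2 * (Complex.I * (Real.sqrt d₂ : ℂ)) * m₂) = 0) :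
    x₁ = 0 ∧ x₂ = 0 := by
  subst hm₁ hm₂
  have hS : (2 * Complex.I) * (((x₁ * Real.sqrt d₁ * k₁ + x₂ * Real.sqrt d₂ * k₂ : ℝ) : ℂ)) = 0 := by
    rw [← h]; push_cast; ring
  have hS' : (x₁ : ℝ) * Real.sqrt d₁ * k₁ + x₂ * Real.sqrt d₂ * k₂ = 0 := by
    rcases mul_eq_zero.1 hS with h0 | h0
    · exact absurd h0 (mul_ne_zero two_ne_zero Complex.I_ne_zero)
    · exact_mod_cast h0
  have hsd₂ : Real.sqrt d₂ ≠ 0 := (Real.sqrt_pos.2 (by exact_mod_cast hd₂)).ne'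
  by_cases h1 : (x₁ : ℝ) * k₁ = 0
  · have h2 : (x₂ : ℝ) * Real.sqrt d₂ * k₂ = 0 := by
      have e : (x₁ : ℝ) * Real.sqrt d₁ * k₁ = (x₁ * k₁) * Real.sqrt d₁ := by ring
      rw [e, h1, zero_mul, zero_add] at hS'
      exact hS'
    have hx₂ : (x₂ : ℝ) = 0 := by
      rcases mul_eq_zero.1 h2 with h | h
      · rcases mul_eq_zero.1 h with h' | h'
        · exact h'
        · exact absurd h' hsd₂
      · exact absurd h (by exact_mod_cast hk₂)
    have hx₁ : (x₁ : ℝ) = 0 := by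
      rcases mul_eq_zero.1 h1 with h | h
      · exact h
      · exact absurd h (by exact_mod_cast hk₁)
    exact ⟨by exact_mod_cast hx₁, by exact_mod_cast hx₂⟩
  · exfalso
    have e : Real.sqrt d₁ * ((x₁ : ℝ) * k₁) = -((x₂ : ℝ) * k₂) * Real.sqrt d₂ := by linarith [hS']
    have e2 : (d₁ : ℝ) * ((x₁ : ℝ) * k₁) ^ 2 = ((x₂ : ℝ) * k₂) ^ 2 * d₂ :=
      calc (d₁ : ℝ) * ((x₁ : ℝ) * k₁) ^ 2 = (Real.sqrt d₁ * ((x₁ : ℝ) * k₁)) ^ 2 := by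
            conv_rhs => rw [mul_pow, Real.sq_sqrt (Nat.cast_nonneg _)]
        _ = (-((x₂ : ℝ) * k₂) * Real.sqrt d₂) ^ 2 := by rw [e]
        _ = ((x₂ : ℝ) * k₂) ^ 2 * d₂ := by rw [mul_pow, neg_sq, Real.sq_sqrt (Nat.cast_nonneg _)]
    set q : ℚ := (x₂ * k₂) / (x₁ * k₁) with hq
    have hx : ((x₁ : ℝ) * k₁) ≠ 0 := h1
    have hqR : (d₁ : ℝ) = ((q : ℚ) : ℝ) ^ 2 * d₂ := by
      rw [hq]; push_cast
      rw [div_pow, div_mul_eq_mul_div, eq_div_iff (pow_ne_zero 2 hx), e2]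
    have : (d₁ : ℚ) = q ^ 2 * d₂ := by exact_mod_cast hqR
    exact hfree q this

set_option maxHeartbeats 1600000 in
/-- **`H¹(A₁ × A₂)` is `Θ`-rigid for `A₁`, `A₂` with imaginary-quadratic `End⁰`, unbalanced multiplicities and non-isomorphic fields**
(`dim_ℚ End⁰A_i = 2`, `φ_i ∘ φ_i = −d_i`, `n₊ ≠ n₋`, no ring homomorphism `End⁰A₂ → End⁰A₁`): the trace criterion on the central plane.
[cite: MoonenZarhin1999LowDim, §3 (3.1)] [cite: Gordon1997, 1.13.2] [cite: Deligne1982HodgeCycles, I §3 Prop. 3.6] -/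
theorem hodgeLie_rigid_prod_quadraticEnd_of_isEmpty_ringHom {A₁ A₂ : AbelianVariety ℂ} {m : ℕ} (hP : IsSmoothProjective m (A₁.prod A₂).X)
    (h0₁ : 0 < A₁.dim) (hA₁E : Module.finrank ℚ A₁.endAlgebra = 2) (φ₁ : A₁ ⟶ A₁) {d₁ : ℕ} (hd₁ : 0 < d₁) (hφ₁ : φ₁ ≫ φ₁ = -(d₁ • 𝟙 A₁))
    (hne₁ : eigenMultiplicity A₁ φ₁ (Complex.I * (Real.sqrt d₁ : ℂ)) ≠ eigenMultiplicity A₁ φ₁ (-(Complex.I * (Real.sqrt d₁ : ℂ))))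
    (h0₂ : 0 < A₂.dim) (hA₂E : Module.finrank ℚ A₂.endAlgebra = 2) (φ₂ : A₂ ⟶ A₂) {d₂ : ℕ} (hd₂ : 0 < d₂) (hφ₂ : φ₂ ≫ φ₂ = -(d₂ • 𝟙 A₂))
    (hne₂ : eigenMultiplicity A₂ φ₂ (Complex.I * (Real.sqrt d₂ : ℂ)) ≠ eigenMultiplicity A₂ φ₂ (-(Complex.I * (Real.sqrt d₂ : ℂ))))
    (hfor : IsEmpty (A₂.endAlgebra →+* A₁.endAlgebra)) :
    haveI := BettiUniverse.finite hP 1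
    ∀ 𝔞 : Submodule ℚ (Module.End ℚ (bettiCohomology (A₁.prod A₂).X 1)),
      𝔞 ≤ (BettiUniverse.hodge exists_isReal_hodgeModel_holds hP 1).hodgeLie →
      (∀ X' ∈ 𝔞, ∀ Y ∈ 𝔞, X' * Y - Y * X' ∈ 𝔞) →
      (∃ Θ ∈ Submodule.span ℂ ((fun X' : Module.End ℚ (bettiCohomology (A₁.prod A₂).X 1) => X'.baseChange ℂ) ''
          (𝔞 : Set (Module.End ℚ (bettiCohomology (A₁.prod A₂).X 1)))),
        ∀ p, ∀ x ∈ (BettiUniverse.hodge exists_isReal_hodgeModel_holds hP 1).piece p (((1 : ℕ) : ℤ) - p),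
          Θ x = ((2 * p - ((1 : ℕ) : ℤ) : ℤ) : ℂ) • x) →
      (BettiUniverse.hodge exists_isReal_hodgeModel_holds hP 1).hodgeLie ≤ 𝔞 := by
  classical
  have hnP : (A₁.prod A₂).dim = m := schemeDim_eq_holds hP
  subst hnP
  have hT : IsSmoothProjective A₁.dim A₁.X := AbelianVariety.isSmoothProjective_holds
  have hT' : IsSmoothProjective A₂.dim A₂.X := AbelianVariety.isSmoothProjective_holds
  haveI := BettiUniverse.finite hP 1
  haveI := BettiUniverse.finite hT 1
  haveI := BettiUniverse.finite hT' 1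
  set φQ₁ : Module.End ℚ (bettiCohomology A₁.X 1) := (bettiCohomology.map φ₁.hom.hom.hom 1).hom with hφQ₁
  set φQ₂ : Module.End ℚ (bettiCohomology A₂.X 1) := (bettiCohomology.map φ₂.hom.hom.hom 1).hom with hφQ₂
  set H := BettiUniverse.hodge exists_isReal_hodgeModel_holds hP 1 with hHdef
  set H₁ := BettiUniverse.hodge exists_isReal_hodgeModel_holds hT 1 with hH₁def
  set H₂ := BettiUniverse.hodge exists_isReal_hodgeModel_holds hT' 1 with hH₂def
  obtain ⟨ψ₁⟩ := BettiUniverse.hodge_isPolarizable exists_isReal_hodgeModel_holds hT 1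
  obtain ⟨ψ₂⟩ := BettiUniverse.hodge_isPolarizable exists_isReal_hodgeModel_holds hT' 1
  obtain ⟨ψ⟩ := BettiUniverse.hodge_isPolarizable exists_isReal_hodgeModel_holds hP 1
  obtain ⟨hφ₁E, -, hZ₁⟩ := quadraticEnd_skewCentre_data exists_isReal_hodgeModel_holds hodgePQ_independent_of_hodgeModel_holds h0₁ hA₁E hd₁ hφ₁ ψ₁
  obtain ⟨hφ₂E, -, hZ₂⟩ := quadraticEnd_skewCentre_data exists_isReal_hodgeModel_holds hodgePQ_independent_of_hodgeModel_holds h0₂ hA₂E hd₂ hφ₂ ψ₂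
  -- the bicone of `H¹(A₁ × A₂)`
  let ι₁ := BettiUniverse.pullHodgeHom exists_isReal_hodgeModel_holds hodgePQ_independent_of_hodgeModel_holds hP hT (fst A₁ A₂).hom.hom.hom 1
  let π₁ := BettiUniverse.pullHodgeHom exists_isReal_hodgeModel_holds hodgePQ_independent_of_hodgeModel_holds hT hP
    (prodLift (𝟙 A₁) (0 : A₁ ⟶ A₂)).hom.hom.hom 1
  let ι₂ := BettiUniverse.pullHodgeHom exists_isReal_hodgeModel_holds hodgePQ_independent_of_hodgeModel_holds hP hT' (snd A₁ A₂).hom.hom.hom 1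
  let π₂ := BettiUniverse.pullHodgeHom exists_isReal_hodgeModel_holds hodgePQ_independent_of_hodgeModel_holds hT' hP
    (prodLift (0 : A₂ ⟶ A₁) (𝟙 A₂)).hom.hom.hom 1
  have hsumP : fst A₁ A₂ ≫ prodLift (𝟙 A₁) (0 : A₁ ⟶ A₂) + snd A₁ A₂ ≫ prodLift (0 : A₂ ⟶ A₁) (𝟙 A₂) = 𝟙 _ := by
    refine prod_hom_ext ?_ ?_
    · rw [Preadditive.add_comp, Category.assoc, Category.assoc, prodLift_fst, prodLift_fst, Category.comp_id, comp_zero, add_zero, Category.id_comp]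
    · rw [Preadditive.add_comp, Category.assoc, Category.assoc, prodLift_snd, prodLift_snd, Category.comp_id, comp_zero, zero_add, Category.id_comp]
  have hπι₁ : ∀ v, π₁.toLinearMap (ι₁.toLinearMap v) = v := fun v => pull_pull_eq_self_of_comp_eq_id (prodLift_fst _ _) v
  have hπι₂ : ∀ v, π₂.toLinearMap (ι₂.toLinearMap v) = v := fun v => pull_pull_eq_self_of_comp_eq_id (prodLift_snd _ _) v
  have hsum : ∀ v, ι₁.toLinearMap (π₁.toLinearMap v) + ι₂.toLinearMap (π₂.toLinearMap v) = v := fun v =>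
    pull_pull_add_pull_pull_eq_self _ _ _ _ hsumP v
  set E₁ : Module.End ℚ (bettiCohomology (A₁.prod A₂).X 1) := ι₁.toLinearMap ∘ₗ φQ₁ ∘ₗ π₁.toLinearMap with hE₁def
  set E₂ : Module.End ℚ (bettiCohomology (A₁.prod A₂).X 1) := ι₂.toLinearMap ∘ₗ φQ₂ ∘ₗ π₂.toLinearMap with hE₂def
  -- the skew centre is on `ℚE₁ ⊕ ℚE₂`
  have hZ : ∀ z ∈ H.hodgeLie ⊓ Subalgebra.toSubmodule H.endAlg, ∃ x₁ x₂ : ℚ, z = x₁ • E₁ + x₂ • E₂ := by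
    intro z hz
    obtain ⟨hz𝔥, hzE⟩ := Submodule.mem_inf.1 hz
    rw [Subalgebra.mem_toSubmodule] at hzE
    have hb := eq_sum_blocks_of_mem_hodgeLie ι₁ π₁ ι₂ π₂ hπι₁ hπι₂ hsum hz𝔥
    have hz₁𝔥 : π₁.toLinearMap ∘ₗ z ∘ₗ ι₁.toLinearMap ∈ H₁.hodgeLie := comp_mem_hodgeLie_of_retract ι₁ π₁ hπι₁ hz𝔥
    have hz₁E : π₁.toLinearMap ∘ₗ z ∘ₗ ι₁.toLinearMap ∈ H₁.endAlg := ((π₁.comp (endAlg.toHom ⟨z, hzE⟩)).comp ι₁).toLinearMap_mem_endAlg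
    obtain ⟨x₁, hx₁⟩ := hZ₁ (π₁.toLinearMap ∘ₗ z ∘ₗ ι₁.toLinearMap) hz₁E
      (fun b hb => commute_of_mem_hodgeLie _ hz₁𝔥 ⟨b, hb⟩) (form_apply_add_eq_zero_of_mem_hodgeLie ψ₁ hz₁𝔥)
    have hz₂𝔥 : π₂.toLinearMap ∘ₗ z ∘ₗ ι₂.toLinearMap ∈ H₂.hodgeLie := comp_mem_hodgeLie_of_retract ι₂ π₂ hπι₂ hz𝔥
    have hz₂E : π₂.toLinearMap ∘ₗ z ∘ₗ ι₂.toLinearMap ∈ H₂.endAlg := ((π₂.comp (endAlg.toHom ⟨z, hzE⟩)).comp ι₂).toLinearMap_mem_endAlg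
    obtain ⟨x₂, hx₂⟩ := hZ₂ (π₂.toLinearMap ∘ₗ z ∘ₗ ι₂.toLinearMap) hz₂E
      (fun b hb => commute_of_mem_hodgeLie _ hz₂𝔥 ⟨b, hb⟩) (form_apply_add_eq_zero_of_mem_hodgeLie ψ₂ hz₂𝔥)
    refine ⟨x₁, x₂, ?_⟩
    rw [hb, hx₁, hx₂]
    simp only [LinearMap.smul_comp, LinearMap.comp_smul, hE₁def, hE₂def, hφQ₁, hφQ₂]
  -- the block traces against `Θ`
  obtain ⟨Θ₀, hΘ₀⟩ := exists_hodgeTheta H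
  have hΘ₁ := restrict_theta_apply ι₁ π₁ hπι₁ Θ₀ hΘ₀
  have hΘ₂ := restrict_theta_apply ι₂ π₂ hπι₂ Θ₀ hΘ₀
  have htr₁ : LinearMap.trace ℂ _ (E₁.baseChange ℂ * Θ₀) = 2 * (Complex.I * (Real.sqrt d₁ : ℂ)) *
      ((eigenMultiplicity A₁ φ₁ (Complex.I * (Real.sqrt d₁ : ℂ)) : ℂ) - (eigenMultiplicity A₁ φ₁ (-(Complex.I * (Real.sqrt d₁ : ℂ))) : ℂ)) := by
    rw [← trace_theta_mul_baseChange_pullback_eq exists_isReal_hodgeModel_holds hodgePQ_independent_of_hodgeModel_holds φ₁ hd₁ hφ₁ hΘ₁]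
    have e1 : E₁.baseChange ℂ * Θ₀ = ι₁.toLinearMap.baseChange ℂ ∘ₗ (φQ₁.baseChange ℂ ∘ₗ π₁.toLinearMap.baseChange ℂ ∘ₗ Θ₀) := by
      rw [hE₁def, LinearMap.baseChange_comp, LinearMap.baseChange_comp]; rfl
    have e2 : (φQ₁.baseChange ℂ ∘ₗ π₁.toLinearMap.baseChange ℂ ∘ₗ Θ₀) ∘ₗ ι₁.toLinearMap.baseChange ℂ =
        φQ₁.baseChange ℂ * (π₁.toLinearMap.baseChange ℂ ∘ₗ Θ₀ ∘ₗ ι₁.toLinearMap.baseChange ℂ) := rfl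
    rw [e1, LinearMap.trace_comp_comm', e2, LinearMap.trace_mul_comm]
  have htr₂ : LinearMap.trace ℂ _ (E₂.baseChange ℂ * Θ₀) = 2 * (Complex.I * (Real.sqrt d₂ : ℂ)) *
      ((eigenMultiplicity A₂ φ₂ (Complex.I * (Real.sqrt d₂ : ℂ)) : ℂ) - (eigenMultiplicity A₂ φ₂ (-(Complex.I * (Real.sqrt d₂ : ℂ))) : ℂ)) := by
    rw [← trace_theta_mul_baseChange_pullback_eq exists_isReal_hodgeModel_holds hodgePQ_independent_of_hodgeModel_holds φ₂ hd₂ hφ₂ hΘ₂]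
    have e1 : E₂.baseChange ℂ * Θ₀ = ι₂.toLinearMap.baseChange ℂ ∘ₗ (φQ₂.baseChange ℂ ∘ₗ π₂.toLinearMap.baseChange ℂ ∘ₗ Θ₀) := by
      rw [hE₂def, LinearMap.baseChange_comp, LinearMap.baseChange_comp]; rfl
    have e2 : (φQ₂.baseChange ℂ ∘ₗ π₂.toLinearMap.baseChange ℂ ∘ₗ Θ₀) ∘ₗ ι₂.toLinearMap.baseChange ℂ =
        φQ₂.baseChange ℂ * (π₂.toLinearMap.baseChange ℂ ∘ₗ Θ₀ ∘ₗ ι₂.toLinearMap.baseChange ℂ) := rfl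
    rw [e1, LinearMap.trace_comp_comm', e2, LinearMap.trace_mul_comm]
  have hfree : ∀ s : ℚ, (d₁ : ℚ) ≠ s ^ 2 * d₂ := forall_ne_sq_mul_of_isEmpty_ringHom hfor hA₂E hd₂ hφ₂ hφ₁ hd₁
  have hk₁ : ((eigenMultiplicity A₁ φ₁ (Complex.I * (Real.sqrt d₁ : ℂ)) : ℤ) - eigenMultiplicity A₁ φ₁ (-(Complex.I * (Real.sqrt d₁ : ℂ))) : ℤ) ≠ 0 := by
    omega
  have hk₂ : ((eigenMultiplicity A₂ φ₂ (Complex.I * (Real.sqrt d₂ : ℂ)) : ℤ) - eigenMultiplicity A₂ φ₂ (-(Complex.I * (Real.sqrt d₂ : ℂ))) : ℤ) ≠ 0 := by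
    omega
  -- the trace criterion
  refine rigid_of_forall_center_trace_theta H ⟨ψ⟩ hΘ₀ fun c hc htr => ?_
  obtain ⟨x₁, x₂, rfl⟩ := hZ c hc
  have hlin : LinearMap.trace ℂ _ ((x₁ • E₁ + x₂ • E₂).baseChange ℂ * Θ₀) =
      (x₁ : ℂ) * LinearMap.trace ℂ _ (E₁.baseChange ℂ * Θ₀) + (x₂ : ℂ) * LinearMap.trace ℂ _ (E₂.baseChange ℂ * Θ₀) := by
    rw [LinearMap.baseChange_add, LinearMap.baseChange_smul, LinearMap.baseChange_smul, ← algebraMap_smul ℂ x₁, ← algebraMap_smul ℂ x₂,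
      add_mul, smul_mul_assoc, smul_mul_assoc, map_add, map_smul, map_smul, smul_eq_mul, smul_eq_mul, eq_ratCast, eq_ratCast]
  rw [hlin, htr₁, htr₂] at htr
  obtain ⟨hx₁, hx₂⟩ := eq_zero_and_eq_zero_of_sqrt_combination hd₂ hfree (by push_cast; rfl) (by push_cast; rfl) hk₁ hk₂ htr
  rw [hx₁, hx₂, zero_smul, zero_smul, add_zero]

/-- **`t(X) ≥ t(A₁ × A₂)` for `X ∼ (A₁ × A₂) × Y`** (such pairs are monotone factors). [cite: MoonenZarhin1999LowDim, §3 (3.1)] [cite: Gordon1997, 1.13.2] -/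
theorem mtRank_hodge_one_le_of_isIsogenous_quadraticEnd_pair_prod (hX : IsSmoothProjective n X.X) {A₁ A₂ Y : AbelianVariety ℂ} {m : ℕ}
    (hP : IsSmoothProjective m (A₁.prod A₂).X)
    (h0₁ : 0 < A₁.dim) (hA₁E : Module.finrank ℚ A₁.endAlgebra = 2) (φ₁ : A₁ ⟶ A₁) {d₁ : ℕ} (hd₁ : 0 < d₁) (hφ₁ : φ₁ ≫ φ₁ = -(d₁ • 𝟙 A₁))
    (hne₁ : eigenMultiplicity A₁ φ₁ (Complex.I * (Real.sqrt d₁ : ℂ)) ≠ eigenMultiplicity A₁ φ₁ (-(Complex.I * (Real.sqrt d₁ : ℂ))))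
    (h0₂ : 0 < A₂.dim) (hA₂E : Module.finrank ℚ A₂.endAlgebra = 2) (φ₂ : A₂ ⟶ A₂) {d₂ : ℕ} (hd₂ : 0 < d₂) (hφ₂ : φ₂ ≫ φ₂ = -(d₂ • 𝟙 A₂))
    (hne₂ : eigenMultiplicity A₂ φ₂ (Complex.I * (Real.sqrt d₂ : ℂ)) ≠ eigenMultiplicity A₂ φ₂ (-(Complex.I * (Real.sqrt d₂ : ℂ))))
    (hfor : IsEmpty (A₂.endAlgebra →+* A₁.endAlgebra)) (hXP : IsIsogenous X ((A₁.prod A₂).prod Y)) :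
    haveI := BettiUniverse.finite hX 1
    haveI := BettiUniverse.finite hP 1
    (BettiUniverse.hodge exists_isReal_hodgeModel_holds hP 1).mtRank ≤ (BettiUniverse.hodge exists_isReal_hodgeModel_holds hX 1).mtRank :=
  mtRank_hodge_one_le_of_isIsogenous_prod_of_rigid hX hP (by rw [dim_prod]; omega)
    (hodgeLie_rigid_prod_quadraticEnd_of_isEmpty_ringHom hP h0₁ hA₁E φ₁ hd₁ hφ₁ hne₁ h0₂ hA₂E φ₂ hd₂ hφ₂ hne₂ hfor) hXP

end Summit.HodgeConjecture.CorCM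

end
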